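import Summits.AtomisticToContinuum.HydrodynamicLimit.Theorems.BoxDissipativeWeakStrongFluxClosureKinStaticGeneral
import Summits.AtomisticToContinuum.HydrodynamicLimit.Theorems.BoxDissipativeWeakStrongFluxClosureEntVelSqSumExpMoment
import HarnessLib

/-!
# Crux `FluxClosure` (stmt-AtomisticToContinuum-9902, route BoxDissipativeWeakStrong), line `registered`:
# the box-level exponential moment of the summed absolute K-integrand (sub-goal H1a2 of the entropy line for stub K)

Support file (`--supports stmt-AtomisticToContinuum-9902`) for the crux
`Summit.AtomisticToContinuum.HydrodynamicLimit.Theses.BoxDissipativeWeakStrong.FluxClosure`: the registered sub-goal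
H1a2 `box_lintegral_exp_kinEntry_le` of the entropy line for the kinetic stub K (relative-entropy local Gibbsianity ⇒
kinetic isotropy of the box peculiar velocity covariances, through the entropy inequality, which consumes a speed-`n`
exponential moment of `n Σᵢⱼ |Aᵢⱼ|`, `A = Ŝ - m̂⊗m̂/ρ̂ - ρ̂θ̂𝟙` the traceless box peculiar velocity covariance of the
`χ`-weighted box fields). GIVEN THE POSITIONS `q` the velocities of a local Gibbs law are independent Maxwellians
`velMeasure u₀ θ₀ q = ⊗ₐ N(u₀(qₐ), θ₀(qₐ)𝟙)`; from the ONE-SITE exponential moment of the shifted-reference centred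
quadratic (sub-goal H1a1, the HYPOTHESIS here) the file proves, for `0 ≤ χ ≤ C_χ`, `s C_χ ≤ γ₀` and a reference
`(ū, θ')` with `‖u₀ y - ū‖ ≤ δu ≤ 1`, `|θ₀ y - θ'| ≤ δθ` wherever `χ y ≠ 0` (`#supp = #{a : χ(qₐ) ≠ 0}`):
`∫ exp(s n Σᵢⱼ |Aᵢⱼ(zipConfig (q, v), χ)|) dv ≤ C exp(#supp · (C (sC_χ)² + sC_χ · C (δθ + δu²)))`. Steps: (1) pointwise,
the traceless bound `FluxClosureEq.E6.kinStatic_abs_kinEntry_le` at `(ū, θ')` times `n`, summed over the nine pairs: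
`s n Σᵢⱼ|Aᵢⱼ| ≤ Σᵢⱼ 4s|Yᵢⱼ| + Σₖ 12 s Dₖ²/Σₐχ(qₐ)`, `Yᵢⱼ = Σₐ χ(qₐ)((vₐ - ū)ᵢ(vₐ - ū)ⱼ - θ'δᵢⱼ)`, `Dₖ = Σₐ χ(qₐ)(vₐ - ū)ₖ`;
(2) Jensen for `exp` over these twelve terms; (3) `exp(τ Yᵢⱼ)` is a product over the particles: Tonelli and the
one-site bound at `t = τ χ(qₐ)` give `≤ exp(#supp (C₁ (τC_χ)² + τ C_χ (δθ + δu²)))`, then `e^{|y|} ≤ eʸ + e^{-y}`;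
(4) `Dₖ =` centred `Fₖ` + bias `|βₖ| ≤ δu Σχ`, `βₖ²/Σχ ≤ #supp C_χ δu²`, and `Fₖ²/Σχ = (Σₐ cₐ(vₐₖ - u₀(qₐ)ₖ))²` with
`Σ cₐ² ≤ C_χ`, whose `χ²`-type moment is the landed Gc bound `velMeasure_lintegral_exp_sqSum_le`.
Constants: `C = 2304 (C₁ + 1)`, `γ₀ = min (γ₁/48) (1/(1152 θ_M))` from the one-site constants `(C₁, γ₁)` at `θ_M`.

No definitions, no new facts. References: H.-T. Yau, Lett. Math. Phys. 22 (1991) 63–80 (relative entropy method: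
exponential moments under local Gibbs states feed the entropy inequality); C. Kipnis, C. Landim, *Scaling Limits of
Interacting Particle Systems* (1999), Appendix 1 §8; H. Spohn, *Large Scale Dynamics of Interacting Particles* (1991),
Part I §2.3 (local equilibrium states: Maxwellian velocities given the positions).
-/

noncomputable section

namespace Summit.AtomisticToContinuum.HydrodynamicLimit.Theorems
namespace FluxClosureEnt

open scoped BigOperators Topology Classical MeasureTheory ProbabilityTheory InnerProductSpace ENNReal
open Filter Set Function MeasureTheory ProbabilityTheory
open Literature.MathematicalPhysics.KineticTheory Literature.Analysis.FluidPDE Literature.Analysis.FunctionSpaces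
open Summit.AtomisticToContinuum.HydrodynamicLimit.Theses.BoxDissipativeWeakStrong

/-- **Averaging by Jensen, `lintegral` form.** For a finite nonempty index type `ι` (`m = card ι`) and measurable `fₖ`:
if `∫ exp(m fₖ) ≤ B` for every `k` then `∫ exp(Σₖ fₖ) ≤ B` (pointwise `exp(Σₖ fₖ) ≤ m⁻¹ Σₖ exp(m fₖ)`, convexity). -/
theorem entBox_lintegral_exp_sum_le {α ι : Type*} [MeasurableSpace α] {μ : Measure α} [Fintype ι] [Nonempty ι]
    {f : ι → α → ℝ} (hf : ∀ k, Measurable (f k)) {B : ℝ≥0∞}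
    (hB : ∀ k, ∫⁻ x, ENNReal.ofReal (Real.exp (Fintype.card ι * f k x)) ∂μ ≤ B) :
    ∫⁻ x, ENNReal.ofReal (Real.exp (∑ k, f k x)) ∂μ ≤ B := by
  have hm : (0 : ℝ) < Fintype.card ι := Nat.cast_pos.2 Fintype.card_pos
  -- Jensen, adapted from `Literature.Probability.Entropy.exp_sum_le_card_inv_mul_sum_exp`
  have hJ : ∀ x, Real.exp (∑ k, f k x) ≤ (Fintype.card ι : ℝ)⁻¹ * ∑ k, Real.exp (Fintype.card ι * f k x) := by
    intro x
    have h := ConvexOn.map_sum_le convexOn_exp (t := Finset.univ) (w := fun _ : ι => (Fintype.card ι : ℝ)⁻¹)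
      (p := fun k => Fintype.card ι * f k x) (fun _ _ => inv_nonneg.2 hm.le)
      (by rw [Finset.sum_const, Finset.card_univ, nsmul_eq_mul, mul_inv_cancel₀ hm.ne']) fun _ _ => Set.mem_univ _
    simp only [smul_eq_mul, ← mul_assoc, inv_mul_cancel₀ hm.ne', one_mul] at h
    rwa [Finset.mul_sum]
  calc ∫⁻ x, ENNReal.ofReal (Real.exp (∑ k, f k x)) ∂μ
      ≤ ∫⁻ x, ENNReal.ofReal (Fintype.card ι : ℝ)⁻¹ * ∑ k, ENNReal.ofReal (Real.exp (Fintype.card ι * f k x)) ∂μ :=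
        lintegral_mono fun x => by
          rw [← ENNReal.ofReal_sum_of_nonneg fun k _ => (Real.exp_pos _).le, ← ENNReal.ofReal_mul (inv_nonneg.2 hm.le)]
          exact ENNReal.ofReal_le_ofReal (hJ x)
    _ = ENNReal.ofReal (Fintype.card ι : ℝ)⁻¹ * ∑ k, ∫⁻ x, ENNReal.ofReal (Real.exp (Fintype.card ι * f k x)) ∂μ := by
        rw [lintegral_const_mul' _ _ ENNReal.ofReal_ne_top,
          lintegral_finsetSum _ fun k _ => ((hf k).const_mul _).exp.ennreal_ofReal]
    _ ≤ ENNReal.ofReal (Fintype.card ι : ℝ)⁻¹ * ∑ _k : ι, B := mul_le_mul' le_rfl (Finset.sum_le_sum fun k _ => hB k)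
    _ = B := by
        rw [Finset.sum_const, Finset.card_univ, nsmul_eq_mul, ← mul_assoc, ENNReal.ofReal_inv_of_pos hm,
          ENNReal.ofReal_natCast, ENNReal.inv_mul_cancel (by exact_mod_cast hm.ne') (ENNReal.natCast_ne_top _), one_mul]

/-- **Pointwise bound for the summed absolute K-integrand of `zipConfig (q, v)`** (`n ≠ 0`, `χ ≥ 0`, `s ≥ 0`), for an
arbitrary reference `(ū, θ')`: `s n Σᵢⱼ |Aᵢⱼ| ≤ Σᵢⱼ 4 s |Yᵢⱼ| + Σₖ 12 s Dₖ²/Σₐχ(qₐ)`, `Yᵢⱼ = Σₐ χ(qₐ)((vₐ - ū)ᵢ(vₐ - ū)ⱼ - θ'δᵢⱼ)`,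
`Dₖ = Σₐ χ(qₐ)(vₐ - ū)ₖ` — the traceless bound `FluxClosureEq.E6.kinStatic_abs_kinEntry_le` times `n` (`ρ̂ = n⁻¹Σₐχ(qₐ)`),
summed over the nine pairs (the diagonal sum is part of the full sum). -/
theorem entBox_kinEntry_pointwise {n : ℕ} (hn : n ≠ 0) (q : Fin n → T3) {χ : T3 → ℝ} (hχ0 : ∀ y, 0 ≤ χ y)
    (ū : V3) (θ' : ℝ) (v : Fin n → V3) {s : ℝ} (hs : 0 ≤ s) :
    s * (n : ℝ) * ∑ i, ∑ j, |(∫ y, χ y.1 * (y.2 i * y.2 j) ∂(empiricalMeasure (zipConfig (q, v)))) -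
        empiricalMomentumField (zipConfig (q, v)) χ i * empiricalMomentumField (zipConfig (q, v)) χ j /
          empiricalDensityField (zipConfig (q, v)) χ -
        (if i = j then empiricalDensityField (zipConfig (q, v)) χ *
          (2 / 3 * (empiricalEnergyField (zipConfig (q, v)) χ / empiricalDensityField (zipConfig (q, v)) χ -
            ‖empiricalMomentumField (zipConfig (q, v)) χ‖ ^ 2 / (2 * empiricalDensityField (zipConfig (q, v)) χ ^ 2)))
        else 0)| ≤
      ∑ i, ∑ j, 4 * s * |∑ a, χ (q a) * ((v a i - ū i) * (v a j - ū j) - if i = j then θ' else 0)| +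
        ∑ k, 12 * s * ((∑ a, χ (q a) * (v a k - ū k)) ^ 2 / ∑ a, χ (q a)) := by
  obtain ⟨S, hS⟩ : ∃ S : ℝ, S = ∑ a, χ (q a) := ⟨_, rfl⟩
  obtain ⟨Yt, hYt⟩ : ∃ Y : Fin 3 → Fin 3 → ℝ, ∀ i j, Y i j =
      ∑ a, χ (q a) * ((v a i - ū i) * (v a j - ū j) - if i = j then θ' else 0) := ⟨_, fun _ _ => rfl⟩
  obtain ⟨Dt, hDt⟩ : ∃ D : Fin 3 → ℝ, ∀ k, D k = ∑ a, χ (q a) * (v a k - ū k) := ⟨_, fun _ => rfl⟩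
  obtain ⟨R, hR⟩ : ∃ R : ℝ, R = (n : ℝ)⁻¹ * S := ⟨_, rfl⟩
  have hDens : empiricalDensityField (zipConfig (q, v)) χ = R := by
    rw [hR, hS]; exact LGFS.empiricalDensityField_zip q v χ
  simp only [hDens]
  -- the variables of the traceless bound (with the `n⁻¹`-weights) are `Z = n⁻¹ Y`, `D = n⁻¹ Dt`
  obtain ⟨Z, hZ⟩ : ∃ Z : Fin 3 → Fin 3 → ℝ, ∀ i j, Z i j =
      (∑ a, (n : ℝ)⁻¹ * χ (q a) * ((v a i - ū i) * (v a j - ū j))) - (if i = j then θ' * R else 0) :=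
    ⟨_, fun _ _ => rfl⟩
  obtain ⟨D, hD⟩ : ∃ D : Fin 3 → ℝ, ∀ k, D k =
      (n : ℝ)⁻¹ * ∑ a, χ (q a) * v a k - (n : ℝ)⁻¹ * ∑ a, χ (q a) * ū k := ⟨_, fun _ => rfl⟩
  have hn' : (n : ℝ) ≠ 0 := Nat.cast_ne_zero.2 hn
  have hn0 : 0 ≤ (n : ℝ)⁻¹ := inv_nonneg.2 (Nat.cast_nonneg n)
  have hZY : ∀ i j, Z i j = (n : ℝ)⁻¹ * Yt i j := by
    intro i j
    rw [hZ, hYt, hR, hS]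
    by_cases hij : i = j
    · simp only [if_pos hij, Finset.mul_sum, ← Finset.sum_sub_distrib]
      exact Finset.sum_congr rfl fun a _ => by ring
    · simp only [if_neg hij, sub_zero, Finset.mul_sum]
      exact Finset.sum_congr rfl fun a _ => by ring
  have hDD : ∀ k, D k = (n : ℝ)⁻¹ * Dt k := by
    intro k
    rw [hD, hDt, ← mul_sub, ← Finset.sum_sub_distrib]
    exact congrArg _ (Finset.sum_congr rfl fun a _ => by ring)
  have hkey : ∀ i j, (n : ℝ) * (|Z i j| + (∑ k, |Z k k|) / 3 + 4 / 3 * ((∑ k, D k ^ 2) / R)) =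
      |Yt i j| + (∑ k, |Yt k k|) / 3 + 4 / 3 * ((∑ k, Dt k ^ 2) / S) := by
    intro i j
    simp only [hZY, hDD, hR, abs_mul, abs_of_nonneg hn0, mul_pow, ← Finset.mul_sum]
    rw [mul_div_mul_comm, show (n : ℝ)⁻¹ ^ 2 / (n : ℝ)⁻¹ = (n : ℝ)⁻¹ by
      rw [sq, mul_div_assoc, div_self (inv_ne_zero hn'), mul_one]]
    field_simp
  -- nine-pair bookkeeping: the diagonal sum is part of the full sum
  have h9 : ∑ i, ∑ j, (|Yt i j| + (∑ k, |Yt k k|) / 3 + 4 / 3 * ((∑ k, Dt k ^ 2) / S)) ≤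
      4 * ∑ i, ∑ j, |Yt i j| + 12 * ((∑ k, Dt k ^ 2) / S) := by
    simp only [Fin.sum_univ_three]
    linarith [abs_nonneg (Yt 0 1), abs_nonneg (Yt 0 2), abs_nonneg (Yt 1 0), abs_nonneg (Yt 1 2),
      abs_nonneg (Yt 2 0), abs_nonneg (Yt 2 1)]
  calc _ ≤ s * (n : ℝ) * ∑ i, ∑ j, (|Z i j| + (∑ k, |Z k k|) / 3 + 4 / 3 * ((∑ k, D k ^ 2) / R)) := by
        refine mul_le_mul_of_nonneg_left (Finset.sum_le_sum fun i _ => Finset.sum_le_sum fun j _ => ?_)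
          (by positivity)
        have h := FluxClosureEq.E6.kinStatic_abs_kinEntry_le n (zipConfig (q, v)) χ hχ0 ū θ' i j
        rw [hDens] at h
        simp only [zipConfig_apply] at h
        simp only [hZ, hD]
        convert h using 3
    _ = s * ∑ i, ∑ j, (|Yt i j| + (∑ k, |Yt k k|) / 3 + 4 / 3 * ((∑ k, Dt k ^ 2) / S)) := by
        rw [mul_assoc, Finset.mul_sum]
        refine congrArg _ (Finset.sum_congr rfl fun i _ => ?_)
        rw [Finset.mul_sum]
        exact Finset.sum_congr rfl fun j _ => hkey i j
    _ ≤ s * (4 * ∑ i, ∑ j, |Yt i j| + 12 * ((∑ k, Dt k ^ 2) / S)) := mul_le_mul_of_nonneg_left h9 hs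
    _ = _ := by
        simp only [hYt, hDt, hS, mul_add, Finset.mul_sum, Finset.sum_div]
        exact congrArg₂ (· + ·) (Finset.sum_congr rfl fun i _ => Finset.sum_congr rfl fun j _ => by ring)
          (Finset.sum_congr rfl fun k _ => by ring)

/-- **`Y`-terms: exponential moment of the absolute weighted sum of shifted-reference centred quadratics.** Under
`velMeasure u₀ θ₀ q = ⊗ₐ N(u₀(qₐ), θ₀(qₐ)𝟙)` (`0 < θ₀ ≤ θ_M`), given the one-site bound `hH` (constants `C₁, γ₁`), for
`0 ≤ τ`, `τ C_χ ≤ γ₁`: `∫ exp(τ |Σₐ χ(qₐ)((vₐ - ū)ᵢ(vₐ - ū)ⱼ - θ'δᵢⱼ)|) dv ≤ 2 exp(#supp · (C₁ (τ C_χ)² + τ C_χ (δθ + δu²)))`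
(signed version: a product over the particles, Tonelli over the product measure and the one-site bound at `t = ±τ χ(qₐ)`,
the factor being `1` where `χ(qₐ) = 0`; then `e^{|y|} ≤ eʸ + e^{-y}`). -/
theorem entBox_lintegral_exp_abs_quadSum_le {C₁ γ₁ θM : ℝ} (hC₁ : 0 ≤ C₁)
    (hH : ∀ (u ū : V3) (θ θ' δu δθ : ℝ), 0 < θ → θ ≤ θM → 0 ≤ δu → δu ≤ 1 → 0 ≤ δθ → ‖u - ū‖ ≤ δu →
      |θ - θ'| ≤ δθ → ∀ (i j : Fin 3) (t : ℝ), |t| ≤ γ₁ →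
        ∫⁻ w, ENNReal.ofReal (Real.exp (t * ((w i - ū i) * (w j - ū j) - if i = j then θ' else 0)))
          ∂(gaussMeasure u θ) ≤ ENNReal.ofReal (Real.exp (C₁ * t ^ 2 + |t| * (δθ + δu ^ 2))))
    {n : ℕ} (q : Fin n → T3) {u₀ : T3 → V3} {θ₀ : T3 → ℝ} (hθ0 : ∀ x, 0 < θ₀ x) (hθM : ∀ x, θ₀ x ≤ θM)
    {χ : T3 → ℝ} {Cχ : ℝ} (hχ0 : ∀ y, 0 ≤ χ y) (hχC : ∀ y, χ y ≤ Cχ) {ū : V3} {θ' δu δθ : ℝ} (hδu0 : 0 ≤ δu)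
    (hδu1 : δu ≤ 1) (hδθ : 0 ≤ δθ) (hloc : ∀ y, χ y ≠ 0 → ‖u₀ y - ū‖ ≤ δu ∧ |θ₀ y - θ'| ≤ δθ) (i j : Fin 3)
    {τ : ℝ} (hτ0 : 0 ≤ τ) (hτ : τ * Cχ ≤ γ₁) :
    ∫⁻ v, ENNReal.ofReal (Real.exp (τ * |∑ a, χ (q a) * ((v a i - ū i) * (v a j - ū j) - if i = j then θ' else 0)|))
        ∂(velMeasure u₀ θ₀ q) ≤
      ENNReal.ofReal (2 * Real.exp (((Finset.univ.filter fun a => χ (q a) ≠ 0).card : ℝ) *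
        (C₁ * (τ * Cχ) ^ 2 + τ * Cχ * (δθ + δu ^ 2)))) := by
  obtain ⟨P, hP⟩ : ∃ P : V3 → ℝ, ∀ w, P w = (w i - ū i) * (w j - ū j) - if i = j then θ' else 0 := ⟨_, fun _ => rfl⟩
  have hH' : ∀ (u : V3) (θ : ℝ), 0 < θ → θ ≤ θM → ‖u - ū‖ ≤ δu → |θ - θ'| ≤ δθ → ∀ t : ℝ, |t| ≤ γ₁ →
      ∫⁻ w, ENNReal.ofReal (Real.exp (t * P w)) ∂(gaussMeasure u θ) ≤
        ENNReal.ofReal (Real.exp (C₁ * t ^ 2 + |t| * (δθ + δu ^ 2))) := fun u θ h1 h2 h3 h4 t ht => by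
    simpa only [hP] using hH u ū θ θ' δu δθ h1 h2 hδu0 hδu1 hδθ h3 h4 i j t ht
  simp only [← hP]
  -- signed version, either sign
  have hsigned : ∀ σ : ℝ, |σ| * Cχ ≤ γ₁ →
      ∫⁻ v, ENNReal.ofReal (Real.exp (σ * ∑ a, χ (q a) * P (v a))) ∂(velMeasure u₀ θ₀ q) ≤ ENNReal.ofReal
        (Real.exp (((Finset.univ.filter fun a => χ (q a) ≠ 0).card : ℝ) * (C₁ * (σ * Cχ) ^ 2 + |σ| * Cχ * (δθ + δu ^ 2)))) := by
    intro σ hσ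
    obtain ⟨e, he⟩ : ∃ e : ℝ, e = C₁ * (σ * Cχ) ^ 2 + |σ| * Cχ * (δθ + δu ^ 2) := ⟨_, rfl⟩
    rw [← he]
    -- the one-site factors
    have hsite : ∀ a, ∫⁻ w, ENNReal.ofReal (Real.exp ((σ * χ (q a)) * P w)) ∂(gaussMeasure (u₀ (q a)) (θ₀ (q a))) ≤
        ENNReal.ofReal (Real.exp ((if χ (q a) ≠ 0 then 1 else 0) * e)) := by
      intro a
      by_cases ha : χ (q a) = 0
      · rw [if_neg (not_not.2 ha)]
        simp only [ha, mul_zero, zero_mul, Real.exp_zero, ENNReal.ofReal_one, lintegral_const, measure_univ,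
          mul_one, le_refl]
      · rw [if_pos ha, one_mul, he]
        have ht : |σ * χ (q a)| ≤ γ₁ := by
          rw [abs_mul, abs_of_nonneg (hχ0 _)]; exact (mul_le_mul_of_nonneg_left (hχC _) (abs_nonneg σ)).trans hσ
        refine (hH' (u₀ (q a)) (θ₀ (q a)) (hθ0 _) (hθM _) (hloc (q a) ha).1 (hloc (q a) ha).2 (σ * χ (q a))
          ht).trans (ENNReal.ofReal_le_ofReal (Real.exp_le_exp.2 ?_))
        rw [abs_mul, abs_of_nonneg (hχ0 _)]
        have h1 : (σ * χ (q a)) ^ 2 ≤ (σ * Cχ) ^ 2 := by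
          rw [mul_pow, mul_pow]; exact mul_le_mul_of_nonneg_left (pow_le_pow_left₀ (hχ0 _) (hχC _) 2) (sq_nonneg σ)
        have h2 : |σ| * χ (q a) ≤ |σ| * Cχ := mul_le_mul_of_nonneg_left (hχC _) (abs_nonneg σ)
        nlinarith [mul_le_mul_of_nonneg_left h1 hC₁, mul_le_mul_of_nonneg_right h2 (add_nonneg hδθ (sq_nonneg δu))]
    -- Tonelli over the product measure
    unfold velMeasure
    calc ∫⁻ v, ENNReal.ofReal (Real.exp (σ * ∑ a, χ (q a) * P (v a))) ∂(Measure.pi fun a => gaussMeasure (u₀ (q a)) (θ₀ (q a)))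
        = ∫⁻ v, ∏ a, ENNReal.ofReal (Real.exp ((σ * χ (q a)) * P (v a)))
            ∂(Measure.pi fun a => gaussMeasure (u₀ (q a)) (θ₀ (q a))) := by
          refine lintegral_congr fun v => ?_
          rw [Finset.mul_sum, Real.exp_sum, ENNReal.ofReal_prod_of_nonneg fun a _ => (Real.exp_pos _).le]
          exact Finset.prod_congr rfl fun a _ => by rw [mul_assoc]
      _ = ∏ a, ∫⁻ w, ENNReal.ofReal (Real.exp ((σ * χ (q a)) * P w)) ∂(gaussMeasure (u₀ (q a)) (θ₀ (q a))) :=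
          lintegral_fin_nat_prod_eq_prod (fun a => gaussMeasure (u₀ (q a)) (θ₀ (q a)))
            (f := fun a w => ENNReal.ofReal (Real.exp ((σ * χ (q a)) * P w))) fun a => by simp only [hP]; fun_prop
      _ ≤ ∏ a, ENNReal.ofReal (Real.exp ((if χ (q a) ≠ 0 then 1 else 0) * e)) := Finset.prod_le_prod' fun a _ => hsite a
      _ = ENNReal.ofReal (Real.exp (((Finset.univ.filter fun a => χ (q a) ≠ 0).card : ℝ) * e)) := by
          rw [← Finset.sum_boole, Finset.sum_mul, Real.exp_sum, ENNReal.ofReal_prod_of_nonneg fun a _ => (Real.exp_pos _).le]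
  -- the absolute value: `e^{|y|} ≤ eʸ + e^{-y}`
  obtain ⟨Y, hY⟩ : ∃ Y : (Fin n → V3) → ℝ, ∀ v, Y v = ∑ a, χ (q a) * P (v a) := ⟨_, fun _ => rfl⟩
  have hplus := hsigned τ (by rwa [abs_of_nonneg hτ0])
  have hminus := hsigned (-τ) (by rwa [abs_neg, abs_of_nonneg hτ0])
  simp only [← hY, neg_mul, neg_sq, abs_neg, abs_of_nonneg hτ0] at hplus hminus ⊢
  have hF : Measurable fun v : Fin n → V3 => ENNReal.ofReal (Real.exp (τ * Y v)) := by simp only [hY, hP]; fun_prop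
  calc ∫⁻ v, ENNReal.ofReal (Real.exp (τ * |Y v|)) ∂(velMeasure u₀ θ₀ q)
      ≤ ∫⁻ v, ENNReal.ofReal (Real.exp (τ * Y v)) + ENNReal.ofReal (Real.exp (-(τ * Y v))) ∂(velMeasure u₀ θ₀ q) :=
        lintegral_mono fun v => by
          rw [← ENNReal.ofReal_add (Real.exp_pos _).le (Real.exp_pos _).le]
          refine ENNReal.ofReal_le_ofReal ?_
          rcases le_total 0 (Y v) with h | h
          · rw [abs_of_nonneg h]; linarith [Real.exp_pos (-(τ * Y v))]
          · rw [abs_of_nonpos h, mul_neg]; linarith [Real.exp_pos (τ * Y v)]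
    _ = (∫⁻ v, ENNReal.ofReal (Real.exp (τ * Y v)) ∂(velMeasure u₀ θ₀ q)) +
          ∫⁻ v, ENNReal.ofReal (Real.exp (-(τ * Y v))) ∂(velMeasure u₀ θ₀ q) := lintegral_add_left hF _
    _ ≤ _ := add_le_add hplus hminus
    _ = _ := by rw [ENNReal.ofReal_mul zero_le_two, ENNReal.ofReal_ofNat, two_mul]

/-- **`D`-terms: exponential moment of the squared momentum fluctuation over the box mass.** Under
`velMeasure u₀ θ₀ q = ⊗ₐ N(u₀(qₐ), θ₀(qₐ)𝟙)` (`0 < θ₀ ≤ θ_M`), for `0 ≤ χ ≤ C_χ`, a reference `ū` with `‖u₀ y - ū‖ ≤ δu`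
wherever `χ y ≠ 0`, `0 ≤ τ` and `8 τ θ_M C_χ ≤ 1`: `∫ exp(τ (Σₐ χ(qₐ)(vₐₖ - ūₖ))² / Σₐχ(qₐ)) dv ≤ 2 exp(#supp · 2 τ C_χ δu²)`
(centred part `F = Σₐ χ(qₐ)(vₐₖ - u₀(qₐ)ₖ)` plus a bias `|β| ≤ δu Σχ`; `(F + β)² ≤ 2F² + 2β²`, `β²/Σχ ≤ δu² Σχ ≤ #supp C_χ δu²`,
and `F²/Σχ = (Σₐ cₐ (vₐₖ - u₀(qₐ)ₖ))²` with `cₐ = χ(qₐ)/√Σχ`, `Σ cₐ² ≤ C_χ`, whose moment is the landed Gc bound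
`velMeasure_lintegral_exp_sqSum_le`, `≤ exp(4 τ θ_M C_χ) ≤ e^{1/2} ≤ 2`). -/
theorem entBox_lintegral_exp_momSq_le {θM : ℝ} {n : ℕ} (q : Fin n → T3) {u₀ : T3 → V3} {θ₀ : T3 → ℝ}
    (hθ0 : ∀ x, 0 < θ₀ x) (hθM : ∀ x, θ₀ x ≤ θM) {χ : T3 → ℝ} {Cχ : ℝ} (hχ0 : ∀ y, 0 ≤ χ y)
    (hχC : ∀ y, χ y ≤ Cχ) {ū : V3} {δu : ℝ} (hloc : ∀ y, χ y ≠ 0 → ‖u₀ y - ū‖ ≤ δu)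
    (k : Fin 3) {τ : ℝ} (hτ0 : 0 ≤ τ) (hτ : 8 * τ * θM * Cχ ≤ 1) :
    ∫⁻ v, ENNReal.ofReal (Real.exp (τ * ((∑ a, χ (q a) * (v a k - ū k)) ^ 2 / ∑ a, χ (q a))))
        ∂(velMeasure u₀ θ₀ q) ≤
      ENNReal.ofReal (2 * Real.exp (((Finset.univ.filter fun a => χ (q a) ≠ 0).card : ℝ) *
        (2 * τ * Cχ * δu ^ 2))) := by
  obtain ⟨S, hS⟩ : ∃ S : ℝ, S = ∑ a, χ (q a) := ⟨_, rfl⟩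
  obtain ⟨N, hN⟩ : ∃ N : ℝ, N = ((Finset.univ.filter fun a => χ (q a) ≠ 0).card : ℝ) := ⟨_, rfl⟩
  rw [← hS, ← hN]
  have hκ0 : ∀ a, 0 ≤ χ (q a) := fun a => hχ0 _
  have hCχ : 0 ≤ Cχ := (hχ0 0).trans (hχC 0)
  have hθM0 : 0 ≤ θM := (hθ0 0).le.trans (hθM 0)
  have hS0 : 0 ≤ S := by rw [hS]; exact Finset.sum_nonneg fun a _ => hκ0 a
  have hSN : S ≤ N * Cχ := by  -- the box mass is at most `#supp C_χ`
    rw [hS, ← Finset.sum_filter_ne_zero, hN]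
    exact (Finset.sum_le_sum fun a _ => hχC (q a)).trans_eq (by rw [Finset.sum_const, nsmul_eq_mul])
  -- the normalised coefficients and the bias
  obtain ⟨c, hc⟩ : ∃ c : Fin n → ℝ, ∀ a, c a = χ (q a) / Real.sqrt S := ⟨_, fun _ => rfl⟩
  have hc2 : ∑ a, c a ^ 2 ≤ Cχ := by
    have h1 : ∑ a, c a ^ 2 = (∑ a, χ (q a) ^ 2) / S := by
      rw [Finset.sum_div]; exact Finset.sum_congr rfl fun a _ => by rw [hc, div_pow, Real.sq_sqrt hS0]
    rw [h1, hS]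
    refine div_le_of_le_mul₀ (hS ▸ hS0) hCχ ?_
    rw [Finset.mul_sum]
    exact Finset.sum_le_sum fun a _ => by rw [sq]; exact mul_le_mul_of_nonneg_right (hχC _) (hκ0 a)
  obtain ⟨β, hβ⟩ : ∃ β : ℝ, β = ∑ a, χ (q a) * (u₀ (q a) k - ū k) := ⟨_, rfl⟩
  have hβle : |β| ≤ S * δu := by
    rw [hβ, hS, Finset.sum_mul]
    refine (Finset.abs_sum_le_sum_abs _ _).trans (Finset.sum_le_sum fun a _ => ?_)
    rw [abs_mul, abs_of_nonneg (hκ0 a)]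
    rcases eq_or_ne (χ (q a)) 0 with h | h
    · rw [h, zero_mul, zero_mul]
    · exact mul_le_mul_of_nonneg_left
        (le_trans (by simpa using PiLp.norm_apply_le (u₀ (q a) - ū) k) (hloc (q a) h)) (hκ0 a)
  -- pointwise split and bound
  have hpt : ∀ v : Fin n → V3, τ * ((∑ a, χ (q a) * (v a k - ū k)) ^ 2 / S) ≤
      2 * τ * S * δu ^ 2 + 2 * τ * (∑ a, c a * (v a k - u₀ (q a) k)) ^ 2 := by
    intro v
    have hsplit : ∑ a, χ (q a) * (v a k - ū k) = (∑ a, χ (q a) * (v a k - u₀ (q a) k)) + β := by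
      rw [hβ, ← Finset.sum_add_distrib]; exact Finset.sum_congr rfl fun a _ => by ring
    have hsq : (∑ a, χ (q a) * (v a k - u₀ (q a) k)) ^ 2 / S = (∑ a, c a * (v a k - u₀ (q a) k)) ^ 2 := by
      have : ∑ a, c a * (v a k - u₀ (q a) k) = (∑ a, χ (q a) * (v a k - u₀ (q a) k)) / Real.sqrt S := by
        rw [Finset.sum_div]; exact Finset.sum_congr rfl fun a _ => by rw [hc]; ring
      rw [this, div_pow, Real.sq_sqrt hS0]
    rw [hsplit, ← hsq]
    have h1 : ((∑ a, χ (q a) * (v a k - u₀ (q a) k)) + β) ^ 2 ≤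
        2 * (∑ a, χ (q a) * (v a k - u₀ (q a) k)) ^ 2 + 2 * β ^ 2 := by
      nlinarith [sq_nonneg ((∑ a, χ (q a) * (v a k - u₀ (q a) k)) - β)]
    have h2 := div_le_div_of_nonneg_right h1 hS0
    rw [add_div, mul_div_assoc, mul_div_assoc] at h2
    have h3 : β ^ 2 / S ≤ S * δu ^ 2 :=
      div_le_of_le_mul₀ hS0 (by positivity) (by nlinarith [sq_le_sq' (abs_le.1 hβle).1 (abs_le.1 hβle).2])
    nlinarith [mul_le_mul_of_nonneg_left h2 hτ0, mul_le_mul_of_nonneg_left h3 hτ0]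
  -- the Gaussian `χ²`-type moment (Gc) and the elementary constants (`exp(1/2) ≤ 2` from `1 + x ≤ eˣ` at `x = -1/2`)
  have hGc := velMeasure_lintegral_exp_sqSum_le u₀ θ₀ θM hθ0 hθM q c k (2 * τ) (by positivity)
    (by nlinarith [mul_le_mul_of_nonneg_left hc2 (by positivity : 0 ≤ 8 * τ * θM)])
  have hexp2 : Real.exp (2 * (2 * τ) * θM * ∑ a, c a ^ 2) ≤ 2 := by
    refine (Real.exp_le_exp.2 (show 2 * (2 * τ) * θM * ∑ a, c a ^ 2 ≤ 1 / 2 by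
      nlinarith [mul_le_mul_of_nonneg_left hc2 (by positivity : 0 ≤ 4 * τ * θM)])).trans ?_
    have h2 := Real.add_one_le_exp (-(1 / 2 : ℝ))
    have h3 : Real.exp (1 / 2) * Real.exp (-(1 / 2)) = 1 := by rw [← Real.exp_add, add_neg_cancel, Real.exp_zero]
    nlinarith [Real.exp_pos (1 / 2 : ℝ), Real.exp_pos (-(1 / 2) : ℝ)]
  have hdet : 2 * τ * S * δu ^ 2 ≤ N * (2 * τ * Cχ * δu ^ 2) := by
    nlinarith [mul_le_mul_of_nonneg_left hSN (by positivity : 0 ≤ 2 * τ * δu ^ 2)]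
  calc ∫⁻ v, ENNReal.ofReal (Real.exp (τ * ((∑ a, χ (q a) * (v a k - ū k)) ^ 2 / S))) ∂(velMeasure u₀ θ₀ q)
      ≤ ∫⁻ v, ENNReal.ofReal (Real.exp (2 * τ * S * δu ^ 2)) *
          ENNReal.ofReal (Real.exp (2 * τ * (∑ a, c a * (v a k - u₀ (q a) k)) ^ 2)) ∂(velMeasure u₀ θ₀ q) := by
        refine lintegral_mono fun v => ?_
        rw [← ENNReal.ofReal_mul (Real.exp_pos _).le, ← Real.exp_add]
        exact ENNReal.ofReal_le_ofReal (Real.exp_le_exp.2 (hpt v))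
    _ = ENNReal.ofReal (Real.exp (2 * τ * S * δu ^ 2)) *
          ∫⁻ v, ENNReal.ofReal (Real.exp (2 * τ * (∑ a, c a * (v a k - u₀ (q a) k)) ^ 2)) ∂(velMeasure u₀ θ₀ q) :=
        lintegral_const_mul' _ _ ENNReal.ofReal_ne_top
    _ ≤ ENNReal.ofReal (Real.exp (N * (2 * τ * Cχ * δu ^ 2))) * ENNReal.ofReal 2 :=
        mul_le_mul' (ENNReal.ofReal_le_ofReal (Real.exp_le_exp.2 hdet)) (hGc.trans (ENNReal.ofReal_le_ofReal hexp2))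
    _ = ENNReal.ofReal (2 * Real.exp (N * (2 * τ * Cχ * δu ^ 2))) := by
        rw [← ENNReal.ofReal_mul (Real.exp_pos _).le, mul_comm]

/-- **H1a2: box-level (given the positions) exponential moment of the summed absolute K-integrand, from the one-site
bound H1a1.** Assume H1a1 (for every `θ_M > 0` there are `C₁ ≥ 0`, `γ₁ > 0` with
`∫ exp(t((wᵢ - ūᵢ)(wⱼ - ūⱼ) - θ'δᵢⱼ)) N(u, θ𝟙)(dw) ≤ exp(C₁t² + |t|(δθ + δu²))` whenever `θ ≤ θ_M`, `‖u - ū‖ ≤ δu ≤ 1`,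
`|θ - θ'| ≤ δθ`, `|t| ≤ γ₁`). Then for every `θ_M > 0` there are `C ≥ 0`, `γ₀ > 0` (`C = 2304(C₁ + 1)`,
`γ₀ = min(γ₁/48, 1/(1152 θ_M))`) such that for all `n`, positions `q`, profiles `0 < θ₀ ≤ θ_M`, weights `0 ≤ χ ≤ C_χ`,
references `(ū, θ')` with `‖u₀ y - ū‖ ≤ δu ≤ 1`, `|θ₀ y - θ'| ≤ δθ` wherever `χ y ≠ 0`, and `0 ≤ s`, `s C_χ ≤ γ₀`:
under `velMeasure u₀ θ₀ q` the summed absolute traceless box peculiar velocity covariance `A = Ŝ - m̂⊗m̂/ρ̂ - ρ̂θ̂𝟙` of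
`zipConfig (q, v)` satisfies `∫ exp(s n Σᵢⱼ |Aᵢⱼ|) dv ≤ C exp(#supp · (C (sC_χ)² + sC_χ · C (δθ + δu²)))`. Proof:
`entBox_kinEntry_pointwise` (twelve terms), Jensen over them (`entBox_lintegral_exp_sum_le`), the `Y`-terms at
`τ = 48 s` (`entBox_lintegral_exp_abs_quadSum_le`) and the `D`-terms at `τ = 144 s` (`entBox_lintegral_exp_momSq_le`). -/
theorem box_lintegral_exp_kinEntry_le : (∀ θM : ℝ, 0 < θM → ∃ C : ℝ, 0 ≤ C ∧ ∃ γ₀ : ℝ, 0 < γ₀ ∧ ∀ (u ū : V3) (θ θ' δu δθ : ℝ), 0 < θ → θ ≤ θM → 0 ≤ δu → δu ≤ 1 → 0 ≤ δθ → ‖u - ū‖ ≤ δu → |θ - θ'| ≤ δθ → ∀ (i j : Fin 3) (t : ℝ), |t| ≤ γ₀ → ∫⁻ w, ENNReal.ofReal (Real.exp (t * ((w i - ū i) * (w j - ū j) - if i = j then θ' else 0))) ∂(gaussMeasure u θ) ≤ ENNReal.ofReal (Real.exp (C * t ^ 2 + |t| * (δθ + δu ^ 2)))) → ∀ θM : ℝ,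 0 < θM → ∃ C : ℝ, 0 ≤ C ∧ ∃ γ₀ : ℝ, 0 < γ₀ ∧ ∀ (n : ℕ) (q : Fin n → T3) (u₀ : T3 → V3) (θ₀ : T3 → ℝ), (∀ x, 0 < θ₀ x) → (∀ x, θ₀ x ≤ θM) → ∀ (χ : T3 → ℝ) (Cχ : ℝ), (∀ y, 0 ≤ χ y) → (∀ y, χ y ≤ Cχ) → ∀ (ū : V3) (θ' δu δθ : ℝ), 0 ≤ δu → δu ≤ 1 → 0 ≤ δθ → (∀ y, χ y ≠ 0 → ‖u₀ y - ū‖ ≤ δu ∧ |θ₀ y - θ'| ≤ δθ) → ∀ (s : ℝ), 0 ≤ s → s * Cχ ≤ γ₀ → ∫⁻ v, ENNReal.ofReal (Real.exp (s * (n : ℝ) * ∑ i, ∑ j, |(∫ y, χ y.1 * (y.2 i * y.2 j) ∂(empiricalMeasure (zipConfig (q, v)))) - empiricalMomentumField (zipConfig (q, v)) χ i * empiricalMomentumField (zipConfig (q, v)) χ j / empiricalDensityField (zipConfig (q, v)) χ - (if i = j then empiricalDensityField (zipConfig (q, v)) χ * (2 / 3 * (empiricalEnergyField (zipConfig (q,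 v)) χ / empiricalDensityField (zipConfig (q, v)) χ - ‖empiricalMomentumField (zipConfig (q, v)) χ‖ ^ 2 / (2 * empiricalDensityField (zipConfig (q, v)) χ ^ 2))) else 0)|)) ∂(velMeasure u₀ θ₀ q) ≤ ENNReal.ofReal (C * Real.exp (((Finset.univ.filter fun a => χ (q a) ≠ 0).card : ℝ) * (C * (s * Cχ) ^ 2 + s * Cχ * (C * (δθ + δu ^ 2))))) := by
  intro hH1 θM hθM
  obtain ⟨C₁, hC₁, γ₁, hγ₁, hH⟩ := hH1 θM hθM
  refine ⟨2304 * (C₁ + 1), by positivity, min (γ₁ / 48) (1 / (1152 * θM)), lt_min (by positivity) (by positivity), ?_⟩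
  intro n q u₀ θ₀ hθ0 hθM' χ Cχ hχ0 hχC ū θ' δu δθ hδu0 hδu1 hδθ hloc s hs hsγ
  have hCχ : 0 ≤ Cχ := (hχ0 0).trans (hχC 0)
  have h48 : 48 * s * Cχ ≤ γ₁ := by linarith [hsγ.trans (min_le_left _ _)]
  have h1152 : 8 * (144 * s) * θM * Cχ ≤ 1 := by
    have h1 := (le_div_iff₀ (by positivity : (0 : ℝ) < 1152 * θM)).1 (hsγ.trans (min_le_right _ _))
    linarith
  set N : ℝ := ((Finset.univ.filter fun a => χ (q a) ≠ 0).card : ℝ) with hN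
  have hN0 : 0 ≤ N := Nat.cast_nonneg _
  set e : ℝ := 2304 * (C₁ + 1) * (s * Cχ) ^ 2 + s * Cχ * (2304 * (C₁ + 1) * (δθ + δu ^ 2)) with he
  have he0 : 0 ≤ e := by positivity
  -- the empty system
  rcases Nat.eq_zero_or_pos n with rfl | hn
  · simp only [Nat.cast_zero, mul_zero, zero_mul, Real.exp_zero, ENNReal.ofReal_one, lintegral_const, measure_univ,
      mul_one]
    exact ENNReal.one_le_ofReal.2 (by nlinarith [Real.one_le_exp (by positivity : 0 ≤ N * e)])
  -- abbreviations; the two families of exponential moments, bounded by the common `B`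
  obtain ⟨S, hS⟩ : ∃ S : ℝ, S = ∑ a, χ (q a) := ⟨_, rfl⟩
  obtain ⟨Yt, hYt⟩ : ∃ Y : Fin 3 → Fin 3 → (Fin n → V3) → ℝ, ∀ i j v, Y i j v =
      ∑ a, χ (q a) * ((v a i - ū i) * (v a j - ū j) - if i = j then θ' else 0) := ⟨_, fun _ _ _ => rfl⟩
  obtain ⟨Dt, hDt⟩ : ∃ D : Fin 3 → (Fin n → V3) → ℝ, ∀ k v, D k v = ∑ a, χ (q a) * (v a k - ū k) :=
    ⟨_, fun _ _ => rfl⟩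
  set B : ℝ≥0∞ := ENNReal.ofReal (2 * Real.exp (N * e)) with hB
  obtain ⟨hX, hW1, hW2⟩ : 0 ≤ (s * Cχ) ^ 2 ∧ 0 ≤ s * Cχ * δθ ∧ 0 ≤ s * Cχ * δu ^ 2 :=
    ⟨sq_nonneg _, by positivity, by positivity⟩
  have hYB : ∀ i j, ∫⁻ v, ENNReal.ofReal (Real.exp (48 * s * |Yt i j v|)) ∂(velMeasure u₀ θ₀ q) ≤ B := by
    intro i j
    simp only [hYt]
    refine (entBox_lintegral_exp_abs_quadSum_le hC₁ hH q hθ0 hθM' hχ0 hχC hδu0 hδu1 hδθ hloc i j (τ := 48 * s)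
      (by positivity) h48).trans (ENNReal.ofReal_le_ofReal (mul_le_mul_of_nonneg_left (Real.exp_le_exp.2
        (mul_le_mul_of_nonneg_left ?_ hN0)) zero_le_two))
    rw [he]
    nlinarith [mul_nonneg hC₁ hW1, mul_nonneg hC₁ hW2, mul_nonneg hC₁ hX]
  have hDB : ∀ k, ∫⁻ v, ENNReal.ofReal (Real.exp (144 * s * (Dt k v ^ 2 / S))) ∂(velMeasure u₀ θ₀ q) ≤ B := by
    intro k
    simp only [hDt, hS]
    refine (entBox_lintegral_exp_momSq_le q hθ0 hθM' hχ0 hχC (fun y hy => (hloc y hy).1) k (τ := 144 * s)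
      (by positivity) h1152).trans (ENNReal.ofReal_le_ofReal (mul_le_mul_of_nonneg_left (Real.exp_le_exp.2
        (mul_le_mul_of_nonneg_left ?_ hN0)) zero_le_two))
    rw [he]
    nlinarith [mul_nonneg hC₁ hX, mul_nonneg hC₁ hW1, mul_nonneg hC₁ hW2]
  -- the twelve terms as one family over `ι = (Fin 3 × Fin 3) ⊕ Fin 3`, and Jensen over `ι`
  obtain ⟨g, hgY, hgD⟩ : ∃ g : (Fin 3 × Fin 3) ⊕ Fin 3 → (Fin n → V3) → ℝ,
      (∀ i j, g (Sum.inl (i, j)) = fun v => 4 * s * |Yt i j v|) ∧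
        ∀ k, g (Sum.inr k) = fun v => 12 * s * (Dt k v ^ 2 / S) :=
    ⟨Sum.elim (fun p v => 4 * s * |Yt p.1 p.2 v|) (fun k v => 12 * s * (Dt k v ^ 2 / S)), fun _ _ => rfl, fun _ => rfl⟩
  have hcard : (Fintype.card ((Fin 3 × Fin 3) ⊕ Fin 3) : ℝ) = 12 := by
    rw [Fintype.card_sum, Fintype.card_prod, Fintype.card_fin]; norm_num
  calc _ ≤ ∫⁻ v, ENNReal.ofReal (Real.exp (∑ x, g x v)) ∂(velMeasure u₀ θ₀ q) :=
        lintegral_mono fun v => ENNReal.ofReal_le_ofReal (Real.exp_le_exp.2 (by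
          rw [Fintype.sum_sum_type, Fintype.sum_prod_type]
          simpa only [hgY, hgD, hYt, hDt, hS] using entBox_kinEntry_pointwise hn.ne' q hχ0 ū θ' v hs))
    _ ≤ B := by
        refine entBox_lintegral_exp_sum_le (f := g) ?_ ?_
        · rintro (⟨i, j⟩ | k)
          · rw [hgY]; simp only [hYt]; fun_prop
          · rw [hgD]; simp only [hDt]; fun_prop
        · rintro (⟨i, j⟩ | k)
          · have h3 : ∀ v, (12 : ℝ) * (4 * s * |Yt i j v|) = 48 * s * |Yt i j v| := fun v => by ring
            simp only [hcard, hgY, h3]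
            exact hYB i j
          · have h3 : ∀ v, (12 : ℝ) * (12 * s * (Dt k v ^ 2 / S)) = 144 * s * (Dt k v ^ 2 / S) := fun v => by ring
            simp only [hcard, hgD, h3]
            exact hDB k
    _ ≤ _ := by
        rw [hB]
        refine ENNReal.ofReal_le_ofReal (mul_le_mul_of_nonneg_right ?_ (Real.exp_pos _).le)
        nlinarith

end FluxClosureEnt
end Summit.AtomisticToContinuum.HydrodynamicLimit.Theorems

end
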